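import Summits.BirchSwinnertonDyer.BirchSwinnertonDyer.Theorems.SignedLowerHalvesSmallImageLowerHalfBothSignsRttJunctionShaIotaSelmer
import Summits.BirchSwinnertonDyer.BirchSwinnertonDyer.Theorems.SignedLowerHalvesSmallImageLowerHalfBothSignsRttJunctionShaPiGlue
import Literature.NumberTheory.GaloisRepresentations.ContinuousH1ClosedSubgroupColimit
import Literature.NumberTheory.EllipticCurves.SubgroupH1ClosedSubgroupColimit
import Literature.NumberTheory.EllipticCurves.Kato2004.IwasawaH1ReductionInfty
import HarnessLib

/-!
# Route `SignedLowerHalves`, crux L `SmallImageLowerHalfBothSigns` (stmt-BirchSwinnertonDyer-23599), line `rtt_w3` v35 — stub S3α″ (`stub_junctionShaPi_ns`),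
# brick α5′-3c: THE KERNEL PROPERTY of the comparison maps — `ι_{n,k} z = 0 ⟹ z` dies in `Ш¹_P(K_{n+a}, A[p^{k+b}])` for some `a, b`

INPUTS hand `bsd-inputs-honda-p1` g29 under LEAD `cruxlead-stmt-BirchSwinnertonDyer-23599` (cell `bsd-ssimc`); helper `--supports stmt-BirchSwinnertonDyer-23599`.
THEOREMS ONLY (no definition, no named fact, no instance, no `sorry`). The one-variable twin of §2–§4 of the tree's
`Literature/…/EllipticUnits/ImaginaryQuadraticMainConjectureClassGroupRowGlue.lean` (JLK 2011 Lemma 5.8, the injectivity `lim→ Ш¹_P(K_n, A[p^k]) ↪ H¹(K_∞, A)`), for an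
ABSTRACT discrete `p`-PRIMARY `Γ_K`-module `A = M` (`htor`) on whose torsion levels `N_P` acts trivially (`hA`):
* §1 `exists_map_layerSubgroup_subset` — the layer groups `π(U_n)` are cofinal among the open neighbourhoods of `π(Gal(K̄/K_∞))` in `G_P` (compactness);
  `coe_resYOIter` (iterated restriction = one `resLe`), `exists_cocycle_inclYOIter` (a cocycle of the iterated inclusion with the SAME values in `A`);
* §2 ★★ `iotaO_kernel` — if `ι_{n,k} z = 0` then `resYOIter (k+b) a (inclYOIter b z) = 0` for some `b, a`: the coboundary witness `a₀ ∈ A` of `ι z = 0` is killed by `p^b`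
  (`htor`), so at level `k + b` the class dies on `π(Gal(K̄/K_∞))` (`a₀ ∈ A[p^{k+b}] = A[p^{k+b}]^{N_P}` by `hA`), hence on some `π(U_{n+a})` (Serre I §2.2 Prop. 8, the tree's
  `SubgroupRepColimit.exists_resLe_eq_zero`); ★ `iotaSel_kernel` — the same for the `strictSelmer`-valued maps `iotaSel` (= the hypothesis `hK` of
  `piLinear_mem_range_iff_of_kernelProperty`).
HONEST FRAMING: cohomological bookkeeping; α5′, S3α″, crux L and BSD are NOT proved here and remain OPEN; BSD is proved for NO curve.
References: [JohnsonLeungKings2011] §5.4 Lemma 5.8 (proof, arXiv p0015:L150–165); [SerreGaloisCohomology1997] I §2.2 Prop. 8, I §2.4–2.5; [Rubin2000] App. B.2;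
[MilneADT2006] I §4 (p. 56).
-/

set_option autoImplicit false
set_option linter.dupNamespace false -- D-0017: single-problem summit, the namespace repeats the problem name by design
noncomputable section

open scoped Classical
open NumberField IsDedekindDomain Field Function CategoryTheory

namespace Summit.BirchSwinnertonDyer.BirchSwinnertonDyer.Theorems.SmallImageRttJunctionSha

open Literature.NumberTheory.EllipticCurves Literature.NumberTheory.GaloisRepresentations
  Literature.NumberTheory.GaloisRepresentations.DiscreteGaloisModule Literature.NumberTheory.GaloisCohomology Literature.NumberTheory.GaloisCohomology.ShaLayer
  Summit.BirchSwinnertonDyer.BirchSwinnertonDyer.Theorems.SmallImageRttD2Seq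

/-! ## §1 Cofinality of the layer groups; cocycles of the iterated transition maps -/

section Layers

variable {K : Type} [Field K] [NumberField K] {p : ℕ} [Fact p.Prime] (κ : ZpExtension K p) (P : Set (HeightOneSpectrum (𝓞 K)))

omit [NumberField K] in
/-- **The layer groups `π(U_n)` are cofinal among the open neighbourhoods of `π(Gal(K̄/K_∞))` in `G_P`** (`Γ_K` compact, `⋂ U_n = ker κ`).
[cite: SerreGaloisCohomology1997, I §2.2 Prop. 8] -/
theorem exists_map_layerSubgroup_subset {W : Set (GaloisGroupUnramifiedOutside K P)} (hW : IsOpen W)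
    (hHW : ((κ.kerSubgroup.map (toUnramifiedQuot K P) : Subgroup (GaloisGroupUnramifiedOutside K P)) : Set (GaloisGroupUnramifiedOutside K P)) ⊆ W) :
    ∃ n : ℕ, (((κ.layerSubgroup n).map (toUnramifiedQuot K P) : Subgroup (GaloisGroupUnramifiedOutside K P)) : Set (GaloisGroupUnramifiedOutside K P)) ⊆ W := by
  haveI : CompactSpace (absoluteGaloisGroup K) := absoluteGaloisGroup_compactSpace K
  have hpre : (κ.kerSubgroup : Set (absoluteGaloisGroup K)) ⊆ toUnramifiedQuot K P ⁻¹' W := fun g hg ↦ hHW (Subgroup.mem_map_of_mem _ hg)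
  obtain ⟨n, hn⟩ := SubgroupH1Colimit.exists_coe_subset_of_antitone κ.layerSubgroup κ.isOpen_layerSubgroup κ.layerSubgroup_antitone
    (fun _ hg ↦ κ.mem_kerSubgroup_of_forall_mem_layerSubgroup hg) (hW.preimage (continuous_toUnramifiedQuot K P)) hpre
  refine ⟨n, ?_⟩
  rintro _ ⟨g, hg, rfl⟩
  exact hn hg

variable (M : Type) [AddCommGroup M] [DistribMulAction (absoluteGaloisGroup K) M] [TopologicalSpace M] [DiscreteTopology M]
  (hstab : ∀ m : M, IsOpen (MulAction.stabilizer (absoluteGaloisGroup K) m : Set (absoluteGaloisGroup K)))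
  (hNP : ∀ n : ℕ, ramificationSubgroup K P ≤ κ.layerSubgroup n) (hA : ∀ k : ℕ, ramificationSubgroup K P ≤ ContinuousRep.ker (torsRep M hstab p k))

/-- **The iterated restriction is ONE restriction** along `π(U_{n+a}) ≤ π(U_n)`. [cite: SerreGaloisCohomology1997, I §2.5] -/
theorem coe_resYOIter (n k a : ℕ) (w : ↥(layerShaRestricted P (torsRep M hstab p k) (κ.layerSubgroup n) 1)) :
    (resYOIter κ P M hstab hNP hA n k a w).1 =
      (resLe ((DiscreteGaloisModule.quotientInvariants (torsRep M hstab p k) (ramificationSubgroup K P)).toTopRep)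
        (Subgroup.map_mono (κ.layerSubgroup_antitone (Nat.le_add_right n a)) :
          (κ.layerSubgroup (n + a)).map (toUnramifiedQuot K P) ≤ (κ.layerSubgroup n).map (toUnramifiedQuot K P)) 1).hom w.1 := by
  induction a with
  | zero => exact (resLe_refl_apply _ _).symm
  | succ a ih =>
    rw [resYOIter_succ, coe_resYO, ih]
    exact resLe_resLe_apply _ _ _ _

/-- **A cocycle of the iterated inclusion `incl^b z ∈ Ш¹_P(K_n, A[p^{k+b}])` with the SAME values in `A`** as a given cocycle of `z`. [cite: SerreGaloisCohomology1997, I §2.4] -/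
theorem exists_cocycle_inclYOIter (n k : ℕ) (z : ↥(layerShaRestricted P (torsRep M hstab p k) (κ.layerSubgroup n) 1))
    (c : contOneCocycles (subgroupRep (DiscreteGaloisModule.quotientInvariants (torsRep M hstab p k) (ramificationSubgroup K P)).toTopRep ((κ.layerSubgroup n).map (toUnramifiedQuot K P))))
    (hc : oneCocycleClass _ c = z.1) (b : ℕ) :
    ∃ cb : contOneCocycles (subgroupRep (DiscreteGaloisModule.quotientInvariants (torsRep M hstab p (k + b)) (ramificationSubgroup K P)).toTopRep
        ((κ.layerSubgroup n).map (toUnramifiedQuot K P))),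
      (inclYOIter κ P M hstab hNP hA n k b z).1 = oneCocycleClass _ cb ∧
        ∀ g, (((cb.1 g : (torsRep M hstab p (k + b)).invariantsOf (ramificationSubgroup K P)) : ↥(torsionPow M p (k + b))) : M) =
          (((c.1 g : (torsRep M hstab p k).invariantsOf (ramificationSubgroup K P)) : ↥(torsionPow M p k)) : M) := by
  induction b with
  | zero => exact ⟨c, hc.symm, fun _ ↦ rfl⟩
  | succ b ih =>
    obtain ⟨cb, hcb, hval⟩ := ih
    refine ⟨contOneCocycles.pullback (ContinuousMonoidHom.id _)
        (resIdHom (subgroupRepMap (ContinuousRep.invariantsHom (N := ramificationSubgroup K P) (torsInclHom M hstab (p := p) (Nat.le_succ (k + b))))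
          ((κ.layerSubgroup n).map (toUnramifiedQuot K P)))) cb, ?_, fun g ↦ ?_⟩
    · rw [inclYOIter_succ, coe_inclYO, hcb]
      exact cohomologyMap_oneCocycleClass _ cb
    · rw [← hval g]
      rfl

end Layers

/-! ## §2 The kernel property -/

section Kernel

variable {K : Type} [Field K] [NumberField K] {p : ℕ} [Fact p.Prime] (κ : ZpExtension K p) (P : Set (HeightOneSpectrum (𝓞 K)))
  (M : Type) [AddCommGroup M] [DistribMulAction (absoluteGaloisGroup K) M] [TopologicalSpace M] [DiscreteTopology M]
  (hstab : ∀ m : M, IsOpen (MulAction.stabilizer (absoluteGaloisGroup K) m : Set (absoluteGaloisGroup K)))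
  (hNP : ∀ n : ℕ, ramificationSubgroup K P ≤ κ.layerSubgroup n) (hA : ∀ k : ℕ, ramificationSubgroup K P ≤ ContinuousRep.ker (torsRep M hstab p k))
  (htor : ∀ m : M, ∃ k : ℕ, p ^ k • m = 0)

omit [NumberField K] [Fact p.Prime] in
/-- The stabilisers of the layer coefficients `A[p^k]^{N_P}` in `G_P` are open. [cite: SerreGaloisCohomology1997, I §2.1] -/
theorem isOpen_setOf_torsCoeff_apply_eq (k : ℕ)
    (w : (DiscreteGaloisModule.quotientInvariants (torsRep M hstab p k) (ramificationSubgroup K P)).toTopRep) :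
    IsOpen {g : GaloisGroupUnramifiedOutside K P |
      (DiscreteGaloisModule.quotientInvariants (torsRep M hstab p k) (ramificationSubgroup K P)).toTopRep.ρ g w = w} :=
  ContinuousRep.isOpen_setOf_apply_eq (DiscreteGaloisModule.quotientInvariants (torsRep M hstab p k) (ramificationSubgroup K P)) w

omit [NumberField K] in
include hA in
/-- **A layer cocycle whose values on `π(Gal(K̄/K_∞))` are the coboundary of a vector of `A[p^k]` (`N_P`-invariant by `hA`) dies there** (`resLe` to `π(ker κ)`).
[cite: SerreGaloisCohomology1997, I §2.5, I §5.1] -/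
theorem resLe_map_kerSubgroup_eq_zero (n k : ℕ)
    (cb : contOneCocycles (subgroupRep (DiscreteGaloisModule.quotientInvariants (torsRep M hstab p k) (ramificationSubgroup K P)).toTopRep
      ((κ.layerSubgroup n).map (toUnramifiedQuot K P))))
    (a₀ : M) (hmem : a₀ ∈ torsionPow M p k)
    (hval : ∀ h : κ.kerSubgroup,
      (((cb.1 (toLayerGroup P (κ.kerSubgroup_le_layerSubgroup n) h) : (torsRep M hstab p k).invariantsOf (ramificationSubgroup K P)) : ↥(torsionPow M p k)) : M) =
        (h : absoluteGaloisGroup K) • a₀ - a₀) :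
    resLe (DiscreteGaloisModule.quotientInvariants (torsRep M hstab p k) (ramificationSubgroup K P)).toTopRep
        (Subgroup.map_mono (κ.kerSubgroup_le_layerSubgroup n) : κ.kerSubgroup.map (toUnramifiedQuot K P) ≤ (κ.layerSubgroup n).map (toUnramifiedQuot K P)) 1
      (oneCocycleClass _ cb) = 0 := by
  have hinv : (⟨a₀, hmem⟩ : ↥(torsionPow M p k)) ∈
      Representation.invariants ((torsRep M hstab p k).toRepresentation.comp (ramificationSubgroup K P).subtype) :=
    ShaLayer.mem_invariants_of_le_ker P (torsRep M hstab p k) (hA k) _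
  rw [SubgroupRepColimit.resLe_oneCocycleClass_eq_zero_iff]
  refine ⟨⟨⟨a₀, hmem⟩, hinv⟩, fun x ↦ ?_⟩
  obtain ⟨h, hh, hx⟩ := Subgroup.mem_map.mp x.2
  have hx' : subgroupInclusion (Subgroup.map_mono (κ.kerSubgroup_le_layerSubgroup n) :
      κ.kerSubgroup.map (toUnramifiedQuot K P) ≤ (κ.layerSubgroup n).map (toUnramifiedQuot K P)) x =
        toLayerGroup P (κ.kerSubgroup_le_layerSubgroup n) ⟨h, hh⟩ := Subtype.ext hx.symm
  have hxG : (x : GaloisGroupUnramifiedOutside K P) = toUnramifiedQuot K P h := hx.symm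
  apply Subtype.ext
  apply Subtype.ext
  have e := hval ⟨h, hh⟩
  rw [← hx'] at e
  rw [e, hxG]
  rfl

/-- **The coboundary witness of `ι_{n,k} z = 0`**: a cocycle `c` of `z` is, on `Gal(K̄/K_∞)`, the coboundary of some `a₀ ∈ A`. [cite: SerreGaloisCohomology1997, I §5.1] -/
theorem exists_witness_of_iotaO_eq_zero (n k : ℕ) (z : ↥(layerShaRestricted P (torsRep M hstab p k) (κ.layerSubgroup n) 1))
    (c : contOneCocycles (subgroupRep (DiscreteGaloisModule.quotientInvariants (torsRep M hstab p k) (ramificationSubgroup K P)).toTopRep ((κ.layerSubgroup n).map (toUnramifiedQuot K P))))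
    (hc : oneCocycleClass _ c = z.1) (hz : iotaO κ P M hstab n k z = 0) :
    ∃ a₀ : M, ∀ h : κ.kerSubgroup,
      (((c.1 (toLayerGroup P (κ.kerSubgroup_le_layerSubgroup n) h) : (torsRep M hstab p k).invariantsOf (ramificationSubgroup K P)) : ↥(torsionPow M p k)) : M) =
        (h : absoluteGaloisGroup K) • a₀ - a₀ := by
  rw [iotaO_apply, ← hc, ShaLayer.toSubgroupH1_oneCocycleClass, oneCocycleClass_eq_zero_iff] at hz
  obtain ⟨a₀, ha₀⟩ := hz
  refine ⟨a₀, fun h ↦ ?_⟩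
  have e := ha₀ h
  rw [pullback_toLayerGroup_apply, discreteTopRep_ρ_apply] at e
  exact e

/-- **Serre I §2.2 Prop. 8 along the cofinal tower `π(U_m)`**: a class of `Ш¹_P(K_n, A[p^k])` dying on `π(Gal(K̄/K_∞))` dies after finitely many restriction steps.
[cite: SerreGaloisCohomology1997, I §2.2 Prop. 8] [cite: Rubin2000, App. B.2] -/
theorem exists_resYOIter_eq_zero (n k : ℕ) (w : ↥(layerShaRestricted P (torsRep M hstab p k) (κ.layerSubgroup n) 1))
    (y : continuousCohomology 1 (subgroupRep (DiscreteGaloisModule.quotientInvariants (torsRep M hstab p k) (ramificationSubgroup K P)).toTopRep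
      ((κ.layerSubgroup n).map (toUnramifiedQuot K P)))) (hy : w.1 = y)
    (hw : resLe (DiscreteGaloisModule.quotientInvariants (torsRep M hstab p k) (ramificationSubgroup K P)).toTopRep
      (Subgroup.map_mono (κ.kerSubgroup_le_layerSubgroup n) : κ.kerSubgroup.map (toUnramifiedQuot K P) ≤ (κ.layerSubgroup n).map (toUnramifiedQuot K P)) 1 y = 0) :
    ∃ a : ℕ, resYOIter κ P M hstab hNP hA n k a w = 0 := by
  subst hy
  obtain ⟨n', hnn', h0⟩ := SubgroupRepColimit.exists_resLe_eq_zero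
    (DiscreteGaloisModule.quotientInvariants (torsRep M hstab p k) (ramificationSubgroup K P)).toTopRep
    (isOpen_setOf_torsCoeff_apply_eq P M hstab k) (fun m ↦ (κ.layerSubgroup m).map (toUnramifiedQuot K P))
    (fun m ↦ isOpen_map_toUnramifiedQuot P _ (κ.isOpen_layerSubgroup m)) (fun m ↦ Subgroup.map_mono (κ.kerSubgroup_le_layerSubgroup m))
    (fun _ _ h ↦ Subgroup.map_mono (κ.layerSubgroup_antitone h)) (fun W hW hHW ↦ exists_map_layerSubgroup_subset κ P hW hHW) w.1 hw
  obtain ⟨a, rfl⟩ := Nat.exists_eq_add_of_le hnn'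
  refine ⟨a, Subtype.ext ?_⟩
  rw [coe_resYOIter]
  exact h0

set_option maxHeartbeats 400000 in
include htor in
/-- ★★ **THE KERNEL PROPERTY of `ι_{n,k} : Ш¹_P(K_n, A[p^k]) → H¹(K_∞, A)`**: if `ι_{n,k} z = 0` then `res^a (incl^b z) = 0` in `Ш¹_P(K_{n+a}, A[p^{k+b}])` for some `b, a` — the
coboundary witness `a₀ ∈ A` of `ι z = 0` on `Gal(K̄/K_∞)` is killed by `p^b` (`A` is `p`-primary), so at level `k + b` the class of `z` dies on `π(Gal(K̄/K_∞)) ≤ G_P`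
(`a₀ ∈ A[p^{k+b}]` is `N_P`-invariant by `hA`), hence on some layer group `π(U_{n+a})` (Serre I §2.2 Prop. 8 along the cofinal tower). [cite: JohnsonLeungKings2011, §5.4 Lemma 5.8
(proof, arXiv p0015:L150–165)] [cite: SerreGaloisCohomology1997, I §2.2 Prop. 8] -/
theorem iotaO_kernel (n k : ℕ) (z : ↥(layerShaRestricted P (torsRep M hstab p k) (κ.layerSubgroup n) 1)) (hz : iotaO κ P M hstab n k z = 0) :
    ∃ b a : ℕ, resYOIter κ P M hstab hNP hA n (k + b) a (inclYOIter κ P M hstab hNP hA n k b z) = 0 := by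
  obtain ⟨c, hc⟩ := oneCocycleClass_surjective _ z.1
  obtain ⟨a₀, ha₀⟩ := exists_witness_of_iotaO_eq_zero κ P M hstab n k z c hc hz
  -- (`have … ; obtain … := this`: `obtain` on a compound term generalises it over the goal, whose `resYOIter`/`inclYOIter` make that isDefEq search explode)
  have hb' := htor a₀
  obtain ⟨b, hb⟩ := hb'
  have hmem : a₀ ∈ torsionPow M p (k + b) := by rw [mem_torsionPow_iff, pow_add, mul_smul, hb, smul_zero]
  have hex := exists_cocycle_inclYOIter κ P M hstab hNP hA n k z c hc b
  obtain ⟨cb, hcb, hval⟩ := hex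
  have hdies := resLe_map_kerSubgroup_eq_zero κ P M hstab hA n (k + b) cb a₀ hmem fun h ↦ (hval _).trans (ha₀ h)
  have hres := exists_resYOIter_eq_zero κ P M hstab hNP hA n (k + b) _ _ hcb hdies
  obtain ⟨a, ha⟩ := hres
  exact ⟨b, a, ha⟩

variable (R : Type*) [Ring R] [Module R M] (V : WeierstrassCurve K) (j : V.geomPrimaryTorsion p →+ M) (S₀ : Set (HeightOneSpectrum (𝓞 K))) (ε : ℤˣ)
  (S₁ : Set (HeightOneSpectrum (𝓞 K)))
  (hpP : ∀ v : HeightOneSpectrum (𝓞 K), ((p : ℕ) : 𝓞 K) ∈ v.asIdeal → v ∈ P) (hS₁ : S₁ ⊆ P)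

include htor in
/-- ★ **The kernel property of the `strictSelmer`-valued comparison maps `iotaSel`** (the hypothesis `hK` of `piLinear_mem_range_iff_of_kernelProperty`).
[cite: JohnsonLeungKings2011, §5.4 Lemma 5.8 (proof, arXiv p0015:L150–165)] [cite: SerreGaloisCohomology1997, I §2.2 Prop. 8] -/
theorem iotaSel_kernel (n k : ℕ) (z : ↥(layerShaRestricted P (torsRep M hstab p k) (κ.layerSubgroup n) 1))
    (hz : iotaSel κ P M hstab R V j S₀ ε S₁ hpP hS₁ n k z = 0) :
    ∃ b a : ℕ, resYOIter κ P M hstab hNP hA n (k + b) a (inclYOIter κ P M hstab hNP hA n k b z) = 0 :=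
  iotaO_kernel κ P M hstab hNP hA htor n k z ((iotaSel_eq_zero_iff κ P M hstab R V j S₀ ε S₁ hpP hS₁ n k z).1 hz)

end Kernel

end Summit.BirchSwinnertonDyer.BirchSwinnertonDyer.Theorems.SmallImageRttJunctionSha

end
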